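import Summits.Schanuel.Schanuel.Theorems.ZilberEacMixedDecoupledLemmas
import Summits.Schanuel.Schanuel.Theorems.ZilberEacExplosionDensity
import Mathlib.Algebra.MvPolynomial.Funext
import HarnessLib

/-!
# MIXED fibres with a DECOUPLED pure block, II: Zariski density via THEOREM K

Zilber's Exponential-Algebraic Closedness, case ladder (host summit Schanuel, cell `pub-schanuel`,
seat 2, gen 11).  O51 (d) asked for MIXED fibres — pure targets `e^{xⱼ} = Aⱼ(x)` next to balancing
ones — over an explosion base, where neither the balance theorem (all `fⱼ ≠ 0`, gen 10) nor the
pure theorem (all `Fⱼ = 0`, `ZilberEacPureTargetsDensity`) applies.  When the pure block is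
DECOUPLED from the balancing variable — `Aⱼ = aⱼ(xⱼ)` univariate for `j ≥ 1` — the `(s+2)`-fold

  `W = {x_{s+1} = g(x), y₀ = A₀(x) + y_{s+1} f₀(y_{s+1}), yⱼ = aⱼ(xⱼ) (1 ≤ j ≤ s)}`

fibres over the discrete set `M = {ν ∈ ℂˢ : e^{νⱼ} = aⱼ(νⱼ)}` (a product of infinite sets, hence
Zariski dense by `MvPolynomial.funext_set`), and on each slice `x' = ν` the remaining equation
`e^{z} = A₀(z, ν) + e^{p_ν(z)} f₀(e^{p_ν(z)})`, `p_ν(z) = g(z, ν)` (`deg p_ν ≥ 2` by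
`two_le_natDegree_of_lineRestrict` from `g_D(1,0,…,0) ≠ 0`), is gen 8's ONE-variable exp–exp balance
(`ZilberEacMixedDecoupledLemmas.exists_balance_solutions_for_nearLine`): solutions ON the line
`x' = ν` with an exponentially large power coordinate — the input of THEOREM K
(`unprojectedDense_polyFibredGraph_of_nearLine`, slopes `λ = 0`, offsets `ν ∈ M`).

**THEOREM (`unprojectedDense_polyFibredGraph_mixedDecoupled`).**  `deg g = D ≥ 2` with
`g_D(1, 0, …, 0) ≠ 0`, `A₀ ∈ ℂ[x₀..x_s]` arbitrary, `aⱼ ∈ ℂ[t] ∖ 0`, `f₀ ∈ ℂ[u] ∖ 0` ⟹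
`I(W ∩ Γ_exp) = I(W)` — NO condition on the sign pattern of `Re g_D` (explosion bases included).
Certified members for `A` dominant (`polyFibredGraph_mixedDecoupled_member_dense`); example in
`EC(3,2)`: **`negSumSquares_mixed_member_dense`** — `{x₂ = -(x₀² + x₁²), y₀ = x₀ + y₂, y₁ = x₁}`
(`e^z = z + e^{-(z²+w²)}`, `e^w = w`): dense.

HONEST FRAMING: explicit families inside an OPEN cell; the COUPLED mixed case (`A₁` depending on
`x₀`) stays open (O52 (d)); `EC(3,2)` OPEN; NOT Schanuel's conjecture; EAC ⇏ SC.
-/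

noncomputable section

open Complex MvPolynomial Filter Topology
open Literature.NumberTheory.Transcendental Literature.ModelTheory.Zilber
  Literature.ModelTheory.ExponentialFields

set_option linter.dupNamespace false

namespace Summit.Schanuel.Schanuel.Theorems

/-! ## Part A. The density theorem -/

section Mixed

variable {s : ℕ}

/-- **THEOREM (mixed fibres, decoupled pure block).**  See the module docstring. (new)
[cite: MantovaMasser2023, §1 p.5 (the open case dim π(V) = 2 in ℂ³×ℂˣ³)] -/
theorem unprojectedDense_polyFibredGraph_mixedDecoupled (g : MvPolynomial (Fin (s + 1)) ℂ)
    (hD : 2 ≤ g.totalDegree)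
    (he₀ : eval (Fin.cons 1 0 : Fin (s + 1) → ℂ) (homogeneousComponent g.totalDegree g) ≠ 0)
    (A₀ : MvPolynomial (Fin (s + 1)) ℂ) (a : Fin s → Polynomial ℂ) (ha : ∀ j, a j ≠ 0)
    (f₀ : Polynomial ℂ) (hf₀ : f₀ ≠ 0) :
    UnprojectedDense (polyFibredGraph g (Fin.cons A₀ fun j => (a j).toMvPolynomial (Fin.succ j))
      (Fin.cons (f₀.toMvPolynomial 0) fun _ => 0)) := by
  classical
  set M : Set (Fin s → ℂ) := {ν | ∀ j, exp (ν j) = (a j).eval (ν j)} with hM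
  refine unprojectedDense_polyFibredGraph_of_nearLine g _ _ (fun _ => 0) M (fun R hR => ?_) ?_
  · -- `M ⊇ Π_j {e^t = a_j(t)}` is Zariski dense
    by_contra hcon
    push Not at hcon
    apply hR
    refine MvPolynomial.funext_set (fun j => {t : ℂ | exp t = (a j).eval t})
      (fun j => setOf_exp_eq_polynomial_eval_infinite (a j) (ha j)) fun ν hν => ?_
    rw [map_zero]
    exact hcon ν fun j => hν j (Set.mem_univ j)
  · intro ν hν
    -- the slice polynomials
    set θ : Fin (s + 1) → Polynomial ℂ := Fin.cons Polynomial.X fun j => Polynomial.C (ν j) with hθ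
    have hθeval : ∀ z : ℂ, (fun i => (θ i).eval z) = (Fin.cons z ν : Fin (s + 1) → ℂ) := by
      intro z; funext i
      refine Fin.cases ?_ (fun j => ?_) i
      · simp [hθ]
      · simp [hθ]
    set p : Polynomial ℂ := aeval θ g with hp
    set Aν : Polynomial ℂ := aeval θ A₀ with hAν
    have hpeval : ∀ z, p.eval z = eval (Fin.cons z ν : Fin (s + 1) → ℂ) g := fun z => by
      rw [hp, polynomial_eval_aeval, hθeval]
    have hAeval : ∀ z, Aν.eval z = eval (Fin.cons z ν : Fin (s + 1) → ℂ) A₀ := fun z => by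
      rw [hAν, polynomial_eval_aeval, hθeval]
    have hline : ∀ z : ℂ, (Fin.cons z ν : Fin (s + 1) → ℂ) =
        z • (Fin.cons 1 0 : Fin (s + 1) → ℂ) + Fin.cons 0 ν := by
      intro z; funext i
      refine Fin.cases ?_ (fun j => ?_) i
      · simp
      · simp
    have hp2 : 2 ≤ p.natDegree :=
      two_le_natDegree_of_lineRestrict g hD (Fin.cons 1 0) (Fin.cons 0 ν) he₀ p fun z => by
        rw [hpeval, hline]
    obtain ⟨z, hz, hsol, hgrow⟩ := exists_balance_solutions_for_nearLine p Aν hp2 hf₀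
    refine ⟨z, fun m => Fin.cons (z m) ν, hz, ?_, fun N => Eventually.of_forall fun m => ?_,
      fun N => ?_⟩
    · filter_upwards [hsol] with m hm j
      refine Fin.cases ?_ (fun i => ?_) j
      · simp only [Fin.cons_zero]
        rw [← hpeval, ← hAeval, hm, MvPolynomial.eval_toMvPolynomial, Fin.cons_zero]
      · simp only [Fin.cons_succ, MvPolynomial.eval_toMvPolynomial, map_zero, mul_zero, add_zero]
        exact hν i
    · have : (Fin.cons (z m) ν : Fin (s + 1) → ℂ) - Fin.cons (z m) (fun j => (0 : ℂ) * z m + ν j) = 0 := by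
        funext i
        refine Fin.cases ?_ (fun j => ?_) i
        · simp
        · simp
      rw [this, norm_zero, mul_zero]
      exact zero_le_one
    · filter_upwards [hgrow N] with m hm
      rwa [← hpeval]

/-- **Certified members with dense exponential points (mixed, decoupled).**  `A` dominant (here:
`aeval (A₀, a₁(x₁), …)` injective), `deg g ≥ 2`, `g_D(1,0,…,0) ≠ 0`, `aⱼ, f₀ ≠ 0`: all seven
hypotheses of `ECCell (s+2) (s+1)`, not linearly split, `W ∩ Γ_exp ≠ ∅`, `I(W ∩ Γ_exp) = I(W)`.
(new) [cite: MantovaMasser2023, §1 p.5 (the open case dim π(V) = 2 in ℂ³×ℂˣ³)] -/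
theorem polyFibredGraph_mixedDecoupled_member_dense (g : MvPolynomial (Fin (s + 1)) ℂ)
    (hD : 2 ≤ g.totalDegree)
    (he₀ : eval (Fin.cons 1 0 : Fin (s + 1) → ℂ) (homogeneousComponent g.totalDegree g) ≠ 0)
    (A₀ : MvPolynomial (Fin (s + 1)) ℂ) (a : Fin s → Polynomial ℂ) (ha : ∀ j, a j ≠ 0)
    (hAinj : Function.Injective (aeval (Fin.cons A₀ fun j => (a j).toMvPolynomial (Fin.succ j)) :
      MvPolynomial (Fin (s + 1)) ℂ →ₐ[ℂ] MvPolynomial (Fin (s + 1)) ℂ))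
    (f₀ : Polynomial ℂ) (hf₀ : f₀ ≠ 0) :
    (IsIrreducibleClosed ℂ (polyFibredGraph g (Fin.cons A₀ fun j => (a j).toMvPolynomial (Fin.succ j))
        (Fin.cons (f₀.toMvPolynomial 0) fun _ => 0)) ∧
      (polyFibredGraph g (Fin.cons A₀ fun j => (a j).toMvPolynomial (Fin.succ j))
        (Fin.cons (f₀.toMvPolynomial 0) fun _ => 0) ∩ torusLocus ℂ (s + 2)).Nonempty ∧
      IsRotund ℂ (s + 2) (polyFibredGraph g (Fin.cons A₀ fun j => (a j).toMvPolynomial (Fin.succ j))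
        (Fin.cons (f₀.toMvPolynomial 0) fun _ => 0) ∩ torusLocus ℂ (s + 2)) ∧
      IsAddFree ℂ (s + 2) (polyFibredGraph g (Fin.cons A₀ fun j => (a j).toMvPolynomial (Fin.succ j))
        (Fin.cons (f₀.toMvPolynomial 0) fun _ => 0) ∩ torusLocus ℂ (s + 2)) ∧
      IsMulFree ℂ (s + 2) (polyFibredGraph g (Fin.cons A₀ fun j => (a j).toMvPolynomial (Fin.succ j))
        (Fin.cons (f₀.toMvPolynomial 0) fun _ => 0) ∩ torusLocus ℂ (s + 2)) ∧
      zariskiDim ℂ (polyFibredGraph g (Fin.cons A₀ fun j => (a j).toMvPolynomial (Fin.succ j))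
        (Fin.cons (f₀.toMvPolynomial 0) fun _ => 0)) = (s + 2 : ℕ) ∧
      addProjDim ℂ (s + 2) (polyFibredGraph g (Fin.cons A₀ fun j => (a j).toMvPolynomial (Fin.succ j))
        (Fin.cons (f₀.toMvPolynomial 0) fun _ => 0)) = (s + 1 : ℕ)) ∧
    ¬ IsLinearSplit ℂ (s + 2) (polyFibredGraph g (Fin.cons A₀ fun j => (a j).toMvPolynomial (Fin.succ j))
        (Fin.cons (f₀.toMvPolynomial 0) fun _ => 0)) ∧
    (polyFibredGraph g (Fin.cons A₀ fun j => (a j).toMvPolynomial (Fin.succ j))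
        (Fin.cons (f₀.toMvPolynomial 0) fun _ => 0) ∩ expGraph ℂ (s + 2)).Nonempty ∧
    UnprojectedDense (polyFibredGraph g (Fin.cons A₀ fun j => (a j).toMvPolynomial (Fin.succ j))
        (Fin.cons (f₀.toMvPolynomial 0) fun _ => 0)) := by
  have hcell := ecCell_hypotheses_polyFibredGraph g _
    (Fin.cons (f₀.toMvPolynomial 0) fun _ => 0) hAinj hD
  have hdense := unprojectedDense_polyFibredGraph_mixedDecoupled g hD he₀ A₀ a ha f₀ hf₀
  refine ⟨hcell, not_isLinearSplit_polyFibredGraph g _ _ (Nat.succ_pos s) hAinj, ?_, hdense⟩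
  obtain ⟨w, hw, -⟩ := hcell.2.1
  exact inter_expGraph_nonempty_of_vanishingIdeal_eq ⟨w, hw⟩ hdense

end Mixed

/-! ## Part B. Example in `EC(3,2)`: `x₂ = -(x₀² + x₁²)`, `y₀ = x₀ + y₂`, `y₁ = x₁` -/

section Example

/-- **A mixed member of `EC(3,2)` over the explosion base**:
`W = {x₂ = -(x₀² + x₁²), y₀ = x₀ + y₂, y₁ = x₁} ⊆ ℂ³ × ℂ³` (`e^z = z + e^{-(z²+w²)}`, `e^w = w`): a
balancing fibre next to a pure one — outside the balance theorem (`f₁ = 0`), the pure theorem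
(`f₀ ≠ 0`) and the puncture theorem (no negative ray).  All seven hypotheses of `ECCell 3 2`, not
linearly split, `W ∩ Γ_exp ≠ ∅` AND `I(W ∩ Γ_exp) = I(W)`. (new)
[cite: MantovaMasser2023, §1 p.5 (the open case dim π(V) = 2 in ℂ³×ℂˣ³)] -/
theorem negSumSquares_mixed_member_dense :
    (IsIrreducibleClosed ℂ (polyFibredGraph (-(X 0 ^ 2 + X 1 ^ 2) : MvPolynomial (Fin 2) ℂ)
        (Fin.cons (X 0) fun j => (Polynomial.X : Polynomial ℂ).toMvPolynomial (Fin.succ j))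
        (Fin.cons ((1 : Polynomial ℂ).toMvPolynomial 0) fun _ => 0)) ∧
      (polyFibredGraph (-(X 0 ^ 2 + X 1 ^ 2) : MvPolynomial (Fin 2) ℂ)
        (Fin.cons (X 0) fun j => (Polynomial.X : Polynomial ℂ).toMvPolynomial (Fin.succ j))
        (Fin.cons ((1 : Polynomial ℂ).toMvPolynomial 0) fun _ => 0) ∩ torusLocus ℂ 3).Nonempty ∧
      IsRotund ℂ 3 (polyFibredGraph (-(X 0 ^ 2 + X 1 ^ 2) : MvPolynomial (Fin 2) ℂ)
        (Fin.cons (X 0) fun j => (Polynomial.X : Polynomial ℂ).toMvPolynomial (Fin.succ j))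
        (Fin.cons ((1 : Polynomial ℂ).toMvPolynomial 0) fun _ => 0) ∩ torusLocus ℂ 3) ∧
      IsAddFree ℂ 3 (polyFibredGraph (-(X 0 ^ 2 + X 1 ^ 2) : MvPolynomial (Fin 2) ℂ)
        (Fin.cons (X 0) fun j => (Polynomial.X : Polynomial ℂ).toMvPolynomial (Fin.succ j))
        (Fin.cons ((1 : Polynomial ℂ).toMvPolynomial 0) fun _ => 0) ∩ torusLocus ℂ 3) ∧
      IsMulFree ℂ 3 (polyFibredGraph (-(X 0 ^ 2 + X 1 ^ 2) : MvPolynomial (Fin 2) ℂ)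
        (Fin.cons (X 0) fun j => (Polynomial.X : Polynomial ℂ).toMvPolynomial (Fin.succ j))
        (Fin.cons ((1 : Polynomial ℂ).toMvPolynomial 0) fun _ => 0) ∩ torusLocus ℂ 3) ∧
      zariskiDim ℂ (polyFibredGraph (-(X 0 ^ 2 + X 1 ^ 2) : MvPolynomial (Fin 2) ℂ)
        (Fin.cons (X 0) fun j => (Polynomial.X : Polynomial ℂ).toMvPolynomial (Fin.succ j))
        (Fin.cons ((1 : Polynomial ℂ).toMvPolynomial 0) fun _ => 0)) = (3 : ℕ) ∧
      addProjDim ℂ 3 (polyFibredGraph (-(X 0 ^ 2 + X 1 ^ 2) : MvPolynomial (Fin 2) ℂ)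
        (Fin.cons (X 0) fun j => (Polynomial.X : Polynomial ℂ).toMvPolynomial (Fin.succ j))
        (Fin.cons ((1 : Polynomial ℂ).toMvPolynomial 0) fun _ => 0)) = (2 : ℕ)) ∧
    ¬ IsLinearSplit ℂ 3 (polyFibredGraph (-(X 0 ^ 2 + X 1 ^ 2) : MvPolynomial (Fin 2) ℂ)
        (Fin.cons (X 0) fun j => (Polynomial.X : Polynomial ℂ).toMvPolynomial (Fin.succ j))
        (Fin.cons ((1 : Polynomial ℂ).toMvPolynomial 0) fun _ => 0)) ∧
    (polyFibredGraph (-(X 0 ^ 2 + X 1 ^ 2) : MvPolynomial (Fin 2) ℂ)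
        (Fin.cons (X 0) fun j => (Polynomial.X : Polynomial ℂ).toMvPolynomial (Fin.succ j))
        (Fin.cons ((1 : Polynomial ℂ).toMvPolynomial 0) fun _ => 0) ∩ expGraph ℂ 3).Nonempty ∧
    UnprojectedDense (polyFibredGraph (-(X 0 ^ 2 + X 1 ^ 2) : MvPolynomial (Fin 2) ℂ)
        (Fin.cons (X 0) fun j => (Polynomial.X : Polynomial ℂ).toMvPolynomial (Fin.succ j))
        (Fin.cons ((1 : Polynomial ℂ).toMvPolynomial 0) fun _ => 0)) := by
  obtain ⟨hdeg, -, -⟩ := negSumSquares_data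
  set g : MvPolynomial (Fin 2) ℂ := -(X 0 ^ 2 + X 1 ^ 2) with hg
  have hhom : g.IsHomogeneous 2 := ((isHomogeneous_X_pow 0 2).add (isHomogeneous_X_pow 1 2)).neg
  have he₀ : eval (Fin.cons 1 0 : Fin 2 → ℂ) (homogeneousComponent g.totalDegree g) ≠ 0 := by
    rw [hdeg, homogeneousComponent_eq_self hhom]
    simp [hg, map_add, map_pow, eval_X]
  -- the target map is `X ↦ X` (identity), hence injective
  have hA : (Fin.cons (X 0) fun j : Fin 1 => (Polynomial.X : Polynomial ℂ).toMvPolynomial (Fin.succ j)) =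
      fun j : Fin 2 => (X j : MvPolynomial (Fin 2) ℂ) := by
    funext j
    refine Fin.cases ?_ (fun i => ?_) j
    · simp
    · simp only [Fin.cons_succ, Polynomial.toMvPolynomial_X]
  have hAinj : Function.Injective
      (aeval (Fin.cons (X 0) fun j : Fin 1 => (Polynomial.X : Polynomial ℂ).toMvPolynomial (Fin.succ j)) :
        MvPolynomial (Fin 2) ℂ →ₐ[ℂ] MvPolynomial (Fin 2) ℂ) := by
    rw [hA, aeval_X_left]; exact fun _ _ h => h
  exact polyFibredGraph_mixedDecoupled_member_dense g (by rw [hdeg]) he₀ (X 0) (fun _ => Polynomial.X)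
    (fun _ => Polynomial.X_ne_zero) hAinj 1 one_ne_zero

end Example

end Summit.Schanuel.Schanuel.Theorems

end
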